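import Literature.NumberTheory.LFunctions.FordSmoothNumbers
import Literature.NumberTheory.LFunctions.WooleyEliminant
import Mathlib.Analysis.Complex.Exponential
import Mathlib.Data.Nat.Choose.Bounds
import HarnessLib

/-!
# Combinatorial inputs for Ford's case `S₃` (Lemma 4.1)

Topic `Literature/NumberTheory/LFunctions`. Everything here is PROVED.

For `ℬ = 𝒞(P, R)` with `R = P^η` (all prime factors of its members lie in `(√R, R]`), Ford's
treatment of the class `S₃` in Lemma 4.1 uses the following counting facts, proved here:

* `FordVK.cardFactors_le_of_mem_smoothSet` — `Ω(n) ≤ ⌊2/η⌋` for `n ∈ 𝒞(P,R)`;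
* `FordVK.card_divisors_le_two_pow_cardFactors` — `τ(n) ≤ 2^{Ω(n)}`;
* `FordVK.card_rad_fiber_le` — `#{w ∈ 𝒞(P,R) : rad w = g} ≤ 2^{⌊2/η⌋}` (compositions);
* `FordVK.card_rad_dvd_le` — `#{g = rad w, w ∈ 𝒞(P,R) : g ∣ J} ≤ (t(t+1))^{⌊2/η⌋} e^{1/η}`
  whenever `0 < J ≤ P^{t(t+1)/2}` (Ford: `(et²)^{2/η}`).

## References

* K. Ford, Proc. London Math. Soc. (3) 85 (2002), 565–633, proof of Lemma 4.1 (case S₃).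
  [Ford2002]
-/

noncomputable section

open Finset ArithmeticFunction Real
open scoped ArithmeticFunction.Omega

namespace Literature.NumberTheory.LFunctions
namespace FordVK

open FordSmooth

/-! ### The radical -/

/-- `rad n = ∏_{p ∣ n} p` (square-free kernel, Ford's `s₀(n)`). [cite: Ford2002, §2 (notation `s₀`)] -/
def rad (n : ℕ) : ℕ := ∏ p ∈ n.primeFactors, p

/-- `rad n ∣ n`. [folklore] -/
theorem rad_dvd (n : ℕ) : rad n ∣ n := Nat.prod_primeFactors_dvd n

/-- `rad n` has the same prime factors as `n`. [folklore] -/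
theorem primeFactors_rad (n : ℕ) : (rad n).primeFactors = n.primeFactors :=
  Nat.primeFactors_prod_primeFactors n

/-- `rad n ∣ k ↔ primeFactors n ⊆ primeFactors k` (`k ≠ 0`). [folklore] -/
theorem rad_dvd_iff {n k : ℕ} (hk : k ≠ 0) : rad n ∣ k ↔ n.primeFactors ⊆ k.primeFactors :=
  Nat.prod_primeFactors_dvd_iff hk

/-- `rad (rad n) = rad n`, in the form `∏_{p ∈ primeFactors (rad n)} p = rad n`. [folklore] -/
theorem rad_rad (n : ℕ) : rad (rad n) = rad n := by
  unfold rad; rw [Nat.primeFactors_prod_primeFactors]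

/-- `rad n ≠ 0`. [folklore] -/
theorem rad_ne_zero (n : ℕ) : rad n ≠ 0 :=
  Finset.prod_ne_zero_iff.2 fun _ hp => (Nat.prime_of_mem_primeFactors hp).ne_zero

/-! ### `Ω` on `𝒞(P,R)` and `τ ≤ 2^Ω` -/

/-- If every prime factor of `n ≠ 0` exceeds `y ≥ 0` then `y^{Ω(n)} ≤ n`. [folklore] -/
theorem pow_cardFactors_le {n : ℕ} (hn : n ≠ 0) {y : ℝ} (hy : 0 ≤ y)
    (h : ∀ p ∈ n.primeFactors, y ≤ p) : y ^ (Ω n) ≤ n := by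
  rw [cardFactors_apply, ← Nat.prod_primeFactorsList hn, Nat.cast_list_prod]
  have key : ∀ l : List ℕ, (∀ p ∈ l, y ≤ p) → y ^ l.length ≤ (l.map (fun p : ℕ => (p : ℝ))).prod := by
    intro l hl
    induction l with
    | nil => simp
    | cons a l ih =>
      rw [List.length_cons, pow_succ, List.map_cons, List.prod_cons, mul_comm]
      have ha := hl a (by simp)
      have hl' := ih fun p hp => hl p (by simp [hp])
      exact mul_le_mul ha hl' (pow_nonneg hy _) (hy.trans ha)
  have := key n.primeFactorsList fun p hp => h p (by
    rw [Nat.mem_primeFactors_iff_mem_primeFactorsList]; exact hp)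
  convert this using 2
  rw [Nat.prod_primeFactorsList hn]

/-- **`Ω(n) ≤ ⌊2/η⌋` on `𝒞(P,R)`**, `R = P^η`, `P ≥ 1`, `η > 0`. [cite: Ford2002, proof of Lemma 4.1
("τ(m) ≤ 2^{Ω(m)} ≤ 2^{2/η}")] -/
theorem cardFactors_le_of_mem_smoothSet {P R η : ℝ} (hP : 1 ≤ P) (hη : 0 < η) (hR : R = P ^ η)
    {n : ℕ} (hn : n ∈ smoothSet P R) : Ω n ≤ ⌊2 / η⌋₊ := by
  rw [mem_smoothSet] at hn
  obtain ⟨hn1, hnP, hgood⟩ := hn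
  have hn0 : n ≠ 0 := by omega
  have hP0 : 0 < P := by linarith
  have hsqrt : Real.sqrt R = P ^ (η / 2) := by
    rw [hR, Real.sqrt_eq_rpow, ← Real.rpow_mul hP0.le]; ring_nf
  have h1 : (P ^ (η / 2)) ^ (Ω n) ≤ n := by
    rw [← hsqrt]
    exact pow_cardFactors_le hn0 (Real.sqrt_nonneg _) fun p hp => (hgood p hp).1.le
  rw [← Real.rpow_natCast, ← Real.rpow_mul hP0.le] at h1
  have h2 : P ^ (η / 2 * (Ω n : ℕ)) ≤ P ^ (1 : ℝ) := by rw [Real.rpow_one]; exact h1.trans hnP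
  rcases hP.eq_or_lt with hP1 | hP1
  · -- `P = 1`: then `n = 1`
    have : (n : ℝ) ≤ 1 := by rw [hP1]; exact hnP
    have hn1' : n = 1 := by exact_mod_cast le_antisymm (by exact_mod_cast this) hn1
    subst hn1'; simp
  · have h3 := (Real.rpow_le_rpow_left_iff hP1).1 h2
    refine Nat.le_floor ?_
    rw [le_div_iff₀ hη]
    nlinarith

/-- `τ(n) ≤ 2^{Ω(n)}`. [folklore] -/
theorem card_divisors_le_two_pow_cardFactors {n : ℕ} (hn : n ≠ 0) :
    n.divisors.card ≤ 2 ^ (Ω n) := by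
  rw [Nat.card_divisors hn, cardFactors_eq_sum_factorization, Finsupp.sum,
    Nat.support_factorization, ← Finset.prod_pow_eq_pow_sum]
  refine Finset.prod_le_prod' fun p _ => ?_
  exact Nat.lt_two_pow_self

/-! ### Cardinalities of the auxiliary sets -/

/-- `|𝒞(Q,R)| ≤ Q`. [folklore] -/
theorem card_smoothSet_le_self {Q R : ℝ} (hQ : 0 ≤ Q) : ((smoothSet Q R).card : ℝ) ≤ Q := by
  have h1 : (smoothSet Q R).card ≤ (Finset.Icc 1 ⌊Q⌋₊).card := card_le_card (filter_subset _ _)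
  rw [Nat.card_Icc] at h1
  calc ((smoothSet Q R).card : ℝ) ≤ ((⌊Q⌋₊ + 1 - 1 : ℕ) : ℝ) := by exact_mod_cast h1
    _ = ⌊Q⌋₊ := by push_cast; ring
    _ ≤ Q := Nat.floor_le hQ

/-- **Compositions bound**: `#{w ∈ 𝒞(P,R) : rad w = g} ≤ 2^{⌊2/η⌋}`.
[cite: Ford2002, proof of Lemma 4.1 ("|{w ≤ P : s₀(w) = g}| … < 2^{2/η}")] -/
theorem card_rad_fiber_le {P R η : ℝ} (hP : 1 ≤ P) (hη : 0 < η) (hR : R = P ^ η) (g : ℕ) :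
    ((smoothSet P R).filter fun w => rad w = g).card ≤ 2 ^ ⌊2 / η⌋₊ := by
  classical
  set N₀ := ⌊2 / η⌋₊ with hN₀
  set S := g.primeFactors with hS
  set n := S.card with hn
  set F := (smoothSet P R).filter fun w => rad w = g with hF
  have hmem : ∀ w ∈ F, w ≠ 0 ∧ w.primeFactors = S ∧ Ω w ≤ N₀ := by
    intro w hw
    rw [hF, mem_filter] at hw
    have hw0 : w ≠ 0 := by have := (mem_smoothSet.1 hw.1).1; omega
    refine ⟨hw0, ?_, cardFactors_le_of_mem_smoothSet hP hη hR hw.1⟩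
    rw [hS, ← hw.2, primeFactors_rad]
  -- `Ω w = ∑_{p ∈ S} w.factorization p ≥ n`
  have hΩ : ∀ w ∈ F, Ω w = ∑ p ∈ S, w.factorization p := by
    intro w hw
    rw [cardFactors_eq_sum_factorization, Finsupp.sum, Nat.support_factorization, (hmem w hw).2.1]
  have hge : ∀ w ∈ F, ∀ p ∈ S, 1 ≤ w.factorization p := by
    intro w hw p hp
    rw [← (hmem w hw).2.1] at hp
    exact Nat.Prime.factorization_pos_of_dvd (Nat.prime_of_mem_primeFactors hp) (hmem w hw).1
      (Nat.dvd_of_mem_primeFactors hp)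
  by_cases hnN : N₀ < n
  · -- the fibre is empty
    have : F = ∅ := by
      refine Finset.eq_empty_of_forall_notMem fun w hw => ?_
      have h1 := (hmem w hw).2.2
      rw [hΩ w hw] at h1
      have h2 : n ≤ ∑ p ∈ S, w.factorization p := by
        rw [hn, Finset.card_eq_sum_ones]
        exact Finset.sum_le_sum (hge w hw)
      omega
    rw [this, Finset.card_empty]; exact Nat.zero_le _
  push Not at hnN
  -- inject into `monoFin n (N₀ - n)`
  have e : S ≃ Fin n := S.equivFin
  have hinj : Set.InjOn (fun w : ℕ => fun i : Fin n => w.factorization (e.symm i).1 - 1) F := by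
    intro w hw w' hw' hww'
    have h0 := (hmem w hw).1
    have h0' := (hmem w' hw').1
    refine Nat.eq_of_factorization_eq h0 h0' fun p => ?_
    by_cases hp : p ∈ S
    · have := congr_fun hww' (e ⟨p, hp⟩)
      simp only [Equiv.symm_apply_apply] at this
      have h1 := hge w hw p hp
      have h2 := hge w' hw' p hp
      omega
    · have h1 : w.factorization p = 0 := by
        rw [← Finsupp.notMem_support_iff, Nat.support_factorization, (hmem w hw).2.1]; exact hp
      have h2 : w'.factorization p = 0 := by
        rw [← Finsupp.notMem_support_iff, Nat.support_factorization, (hmem w' hw').2.1]; exact hp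
      rw [h1, h2]
  have himg : ∀ w ∈ F, (fun i : Fin n => w.factorization (e.symm i).1 - 1) ∈ Wooley.monoFin n (N₀ - n) := by
    intro w hw
    rw [Wooley.mem_monoFin]
    have h1 := (hmem w hw).2.2
    rw [hΩ w hw] at h1
    have hsum : ∑ i : Fin n, (w.factorization (e.symm i).1 - 1) = ∑ p ∈ S, (w.factorization p - 1) := by
      rw [← Finset.sum_coe_sort S]
      exact Fintype.sum_equiv e.symm _ _ fun i => rfl
    rw [hsum]
    have h2 : ∑ p ∈ S, (w.factorization p - 1) + n = ∑ p ∈ S, w.factorization p := by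
      rw [hn, Finset.card_eq_sum_ones, ← Finset.sum_add_distrib]
      exact Finset.sum_congr rfl fun p hp => Nat.sub_add_cancel (hge w hw p hp)
    omega
  calc F.card = (F.image fun w : ℕ => fun i : Fin n => w.factorization (e.symm i).1 - 1).card :=
        (card_image_of_injOn hinj).symm
    _ ≤ (Wooley.monoFin n (N₀ - n)).card := card_le_card fun v hv => by
        rw [Finset.mem_image] at hv
        obtain ⟨w, hw, rfl⟩ := hv
        exact himg w hw
    _ = (n + (N₀ - n)).choose n := Wooley.card_monoFin n (N₀ - n)
    _ = N₀.choose n := by rw [Nat.add_sub_cancel' hnN]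
    _ ≤ 2 ^ N₀ := Nat.choose_le_two_pow _ _

/-- `g ∈ image rad` is determined by its prime factors. [folklore] -/
theorem rad_eq_prod_primeFactors_of_mem_image {C : Finset ℕ} {g : ℕ} (hg : g ∈ C.image rad) :
    g = ∏ p ∈ g.primeFactors, p := by
  rw [Finset.mem_image] at hg
  obtain ⟨w, -, rfl⟩ := hg
  exact (rad_rad w).symm

/-- **The number of admissible `g` dividing `J`** (Ford: "the number of such g is at most
`(et²)^{2/η}`"): for `1 ≤ t`, `0 < J ≤ P^{t(t+1)/2}`, `R = P^η`:
`#{g = rad w : w ∈ 𝒞(P,R), g ∣ J} ≤ (t(t+1))^{⌊2/η⌋} e^{1/η}`.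
[cite: Ford2002, proof of Lemma 4.1 (case S₃, last paragraph)] -/
theorem card_rad_dvd_le {P R η : ℝ} (hP : 1 ≤ P) (hη : 0 < η) (hR : R = P ^ η) {t : ℕ} (ht : 1 ≤ t)
    {J : ℕ} (hJ0 : J ≠ 0) (hJ : (J : ℝ) ≤ P ^ ((t : ℝ) * (t + 1) / 2)) :
    ((((smoothSet P R).image rad).filter fun g => g ∣ J).card : ℝ)
      ≤ ((t : ℝ) * (t + 1)) ^ ⌊2 / η⌋₊ * Real.exp (1 / η) := by
  classical
  set N₀ := ⌊2 / η⌋₊ with hN₀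
  set PF := J.primeFactors.filter (fun p : ℕ => Real.sqrt R < (p : ℝ)) with hPF
  set M := PF.card with hM
  set Gs := ((smoothSet P R).image rad).filter fun g => g ∣ J with hGs
  have hP0 : 0 < P := by linarith
  -- Step 1: `g ↦ primeFactors g` injects `Gs` into the small subsets of `PF`
  set T := (Finset.range (N₀ + 1)).biUnion fun n => Finset.powersetCard n PF with hT
  have hmaps : ∀ g ∈ Gs, g.primeFactors ∈ T := by
    intro g hg
    rw [hGs, mem_filter] at hg
    obtain ⟨hgi, hgJ⟩ := hg
    have hgi' := hgi
    rw [Finset.mem_image] at hgi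
    obtain ⟨w, hw, rfl⟩ := hgi
    rw [hT, Finset.mem_biUnion]
    refine ⟨(rad w).primeFactors.card, ?_, ?_⟩
    · rw [Finset.mem_range, Nat.lt_succ_iff, primeFactors_rad]
      exact (card_primeFactors_le_cardFactors w).trans (cardFactors_le_of_mem_smoothSet hP hη hR hw)
    · rw [Finset.mem_powersetCard]
      refine ⟨fun p hp => ?_, rfl⟩
      rw [hPF, mem_filter]
      refine ⟨Nat.primeFactors_mono hgJ hJ0 hp, ?_⟩
      rw [primeFactors_rad] at hp
      exact ((mem_smoothSet.1 hw).2.2 p hp).1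
  have hinj : Set.InjOn (fun g : ℕ => g.primeFactors) Gs := by
    intro g₁ hg₁ g₂ hg₂ h12
    have e1 := rad_eq_prod_primeFactors_of_mem_image (mem_filter.1 (Finset.mem_coe.1 hg₁)).1
    have e2 := rad_eq_prod_primeFactors_of_mem_image (mem_filter.1 (Finset.mem_coe.1 hg₂)).1
    rw [e1, e2]
    exact congrArg (fun s : Finset ℕ => ∏ p ∈ s, p) h12
  have hcard1 : Gs.card ≤ T.card := by
    rw [← Finset.card_image_of_injOn hinj]
    exact card_le_card fun s hs => by
      rw [Finset.mem_image] at hs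
      obtain ⟨g, hg, rfl⟩ := hs
      exact hmaps g hg
  have hcard2 : T.card ≤ ∑ n ∈ Finset.range (N₀ + 1), M.choose n := by
    refine (Finset.card_biUnion_le).trans (le_of_eq ?_)
    exact Finset.sum_congr rfl fun n _ => by rw [Finset.card_powersetCard]
  -- Step 2: `M ≤ t(t+1)/η`
  have hMle : (M : ℝ) ≤ (t : ℝ) * (t + 1) / η := by
    have hprod_dvd : (∏ p ∈ PF, p) ∣ J :=
      (Finset.prod_dvd_prod_of_subset _ _ _ (filter_subset _ _)).trans (Nat.prod_primeFactors_dvd J)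
    have hprod_le : ((∏ p ∈ PF, p : ℕ) : ℝ) ≤ J := by
      exact_mod_cast Nat.le_of_dvd (Nat.pos_of_ne_zero hJ0) hprod_dvd
    have hpow : (Real.sqrt R) ^ M ≤ ((∏ p ∈ PF, p : ℕ) : ℝ) := by
      rw [hM, Nat.cast_prod, ← Finset.prod_const]
      exact Finset.prod_le_prod (fun _ _ => Real.sqrt_nonneg _) fun p hp => by
        rw [hPF, mem_filter] at hp; exact hp.2.le
    have hsqrt : Real.sqrt R = P ^ (η / 2) := by
      rw [hR, Real.sqrt_eq_rpow, ← Real.rpow_mul hP0.le]; ring_nf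
    rw [hsqrt, ← Real.rpow_natCast, ← Real.rpow_mul hP0.le] at hpow
    have hle : P ^ (η / 2 * (M : ℕ)) ≤ P ^ ((t : ℝ) * (t + 1) / 2) := hpow.trans (hprod_le.trans hJ)
    rcases hP.eq_or_lt with hP1 | hP1
    · -- `P = 1`: then `J = 1` and `PF = ∅`
      have hJ1 : (J : ℝ) ≤ 1 := by rw [← hP1, Real.one_rpow] at hJ; exact hJ
      have : J = 1 := by
        have : J ≤ 1 := by exact_mod_cast hJ1
        omega
      have hPF0 : PF = ∅ := by
        rw [hPF, this, Nat.primeFactors_one, Finset.filter_empty]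
      rw [hM, hPF0, Finset.card_empty, Nat.cast_zero]
      positivity
    · have h3 := (Real.rpow_le_rpow_left_iff hP1).1 hle
      rw [le_div_iff₀ hη]
      nlinarith
  -- Step 3: `∑_{n ≤ N₀} C(M,n) ≤ (t(t+1))^{N₀} e^{1/η}`
  have htt : (1 : ℝ) ≤ (t : ℝ) * (t + 1) := by
    have : (1 : ℝ) ≤ t := by exact_mod_cast ht
    nlinarith
  have hsum : ((∑ n ∈ Finset.range (N₀ + 1), M.choose n : ℕ) : ℝ)
      ≤ ((t : ℝ) * (t + 1)) ^ N₀ * ∑ n ∈ Finset.range (N₀ + 1), (1 / η) ^ n / n.factorial := by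
    rw [Nat.cast_sum, Finset.mul_sum]
    refine Finset.sum_le_sum fun n hn => ?_
    rw [Finset.mem_range, Nat.lt_succ_iff] at hn
    calc ((M.choose n : ℕ) : ℝ) ≤ (M : ℝ) ^ n / n.factorial := Nat.choose_le_pow_div n M
      _ ≤ ((t : ℝ) * (t + 1) / η) ^ n / n.factorial := by
          refine div_le_div_of_nonneg_right (pow_le_pow_left₀ (Nat.cast_nonneg _) hMle n) (by positivity)
      _ = ((t : ℝ) * (t + 1)) ^ n * ((1 / η) ^ n / n.factorial) := by
          rw [div_pow, one_div, inv_pow]; ring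
      _ ≤ ((t : ℝ) * (t + 1)) ^ N₀ * ((1 / η) ^ n / n.factorial) := by
          refine mul_le_mul_of_nonneg_right (pow_le_pow_right₀ htt hn) (by positivity)
  have hexp : ∑ n ∈ Finset.range (N₀ + 1), (1 / η) ^ n / n.factorial ≤ Real.exp (1 / η) :=
    Real.sum_le_exp_of_nonneg (by positivity) _
  calc (Gs.card : ℝ) ≤ ((∑ n ∈ Finset.range (N₀ + 1), M.choose n : ℕ) : ℝ) := by
        exact_mod_cast hcard1.trans hcard2
    _ ≤ ((t : ℝ) * (t + 1)) ^ N₀ * ∑ n ∈ Finset.range (N₀ + 1), (1 / η) ^ n / n.factorial := hsum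
    _ ≤ ((t : ℝ) * (t + 1)) ^ N₀ * Real.exp (1 / η) :=
        mul_le_mul_of_nonneg_left hexp (by positivity)


end FordVK
end Literature.NumberTheory.LFunctions
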